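import Mathlib
import Summits.ValiantsHypothesis.ValiantsHypothesis.Theses.ValuativeGCT
import Summits.ValiantsHypothesis.ValiantsHypothesis.Theorems.GeneratorObstructionsGenInheritanceUpper
import Summits.ValiantsHypothesis.ValiantsHypothesis.Theorems.ValuativeGCTNoValuativeFlipBoundedLength
import Literature.Computability.AlgebraicComplexity.MultiplicityObstructionsProofs

/-!
# Few-row plethysm cap: on shapes with at most `k` rows the per side is a `GL_k`-plethysm number

Crux `ValuativeGCT.ValuativeFlip` (stmt-ValiantsHypothesis-12624), wall-breaker axis 14
("plethysm tables, small cases certified"), in support of line `four-row-count`.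

The per side of the crux inequality at a shape `λ ⊢ mδ` is the multiplicity
`mult_{λ*} ℂ[Δ_m(X₀₀^{m-n} per_n)]` of the dual weight `λ* = (dualOfPartition (m*m) λ).toMatIdx` of
`GL_{m²}`.  If `λ` has at most `k` rows, `λ*` lives on the `k` greatest lexicographic letters of
`MatIdx m` (`toMatIdx_dualOfPartition_eq_extend_topLetters`), and the highest-weight vectors of
`ℂ[Sym^m ℂ^{m²}]` of such a weight are exactly the renamed highest-weight vectors of
`ℂ[Sym^m ℂ^k]` (inheritance in both directions, tree:
`Barriers.rename_mem_highestWeightSpace_coordRep`,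
`GenInheritance.exists_rename_eq_of_mem_highestWeightSpace_coordRep`), so the plethysm coefficient
does not see the other letters: `plethysmCoeff_extend_eq` (alphabet reduction along an upper
embedding of letters) and `plethysmCoeff_toMatIdx_eq_plethysmCoeffOfPartition`
(`pleth_{GL_{m²}}(λ*) = a_λ(δ[m])` computed in `GL_k`, any `k ≥ ℓ(λ)`).  With BLMW's bound
(`orbitMultiplicity_le_plethysmCoeff_holds`): for every form `g` of degree `m` and every `λ` with
`ℓ(λ) ≤ k ≤ m²`, `mult_{λ*} ℂ[Δ_m(g)] ≤ a_λ(δ[m]) = plethysmCoeffOfPartition ℂ k m λ`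
(`orbitMultiplicity_le_plethysmCoeffOfPartition_of_card_parts_le`), in particular for the padded
permanent (`orbitMultiplicity_paddedPer_le_plethysmCoeffOfPartition`): the per side of a flip on a
`≤ k`-row shape is capped by an entry of the `GL_k` plethysm table `a_λ(δ[m])` — for line
`four-row-count`, `k = 4`.

References: BLMW, SIAM J. Comput. 40 (2011) §4.4 (Prop. 4.4.1), §5.3–§5.4 (inheritance);
J. M. Landsberg, *Geometry and Complexity Theory* (2017) §8.4.1; Fulton–Harris §6.1 (plethysm).
-/

set_option linter.dupNamespace false

noncomputable section

namespace Summit.ValiantsHypothesis.ValiantsHypothesis.Theorems.ValuativeFlip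

open MvPolynomial
open scoped BigOperators
open Literature.NumberTheory.DiophantineGeometry Literature.Computability.AlgebraicComplexity
open Literature.Barriers.ValiantsHypothesis

/-! ## Alphabet reduction for plethysm coefficients along an upper embedding of letters -/

section AlphabetReduction

variable {σ τ : Type*} [Fintype σ] [LinearOrder σ] [Fintype τ] [LinearOrder τ] {ι : σ → τ} {m : ℕ}

/-- **Alphabet reduction.** For `ι : σ → τ` strictly monotone onto an upper set of letters and a
weight `χ` of `GL_σ`, the plethysm coefficient of `χ` extended by zero, computed in
`ℂ[Sym^m ℂ^τ]`, equals the plethysm coefficient of `χ` computed in `ℂ[Sym^m ℂ^σ]`: renaming along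
`ι` is a linear isomorphism between the two highest-weight spaces
(`rename_mem_highestWeightSpace_coordRep`, `exists_rename_eq_of_mem_highestWeightSpace_coordRep`,
injectivity of `rename`). BLMW 2011 §5.4; Landsberg 2017 §8.4.1. -/
theorem plethysmCoeff_extend_eq (hι : StrictMono ι) (hup : IsUpperSet (Set.range ι)) (χ : Weight σ) :
    plethysmCoeff ℂ τ m (Function.extend ι χ 0) = plethysmCoeff ℂ σ m χ := by
  classical
  let f : ↥(highestWeightSpace (coordRep σ ℂ m) χ) →ₗ[ℂ]
      ↥(highestWeightSpace (coordRep τ ℂ m) (Function.extend ι χ 0)) :=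
    { toFun := fun F => ⟨rename (degIdxMap hι.injective) F.1,
        rename_mem_highestWeightSpace_coordRep hι hup F.2⟩
      map_add' := fun F G => Subtype.ext (by simp)
      map_smul' := fun c F => Subtype.ext (by simp) }
  have hf : Function.Bijective f := by
    refine ⟨fun F G h => Subtype.ext ?_, fun G => ?_⟩
    · exact rename_injective _ (degIdxMap_injective hι.injective) (congrArg Subtype.val h)
    · obtain ⟨F₀, hF₀, hF₀G⟩ :=
        GenInheritance.exists_rename_eq_of_mem_highestWeightSpace_coordRep (k := ℂ) hι hup G.2
      exact ⟨⟨F₀, hF₀⟩, Subtype.ext hF₀G⟩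
  unfold plethysmCoeff hwMultiplicity
  exact ((LinearEquiv.ofBijective f hf).finrank_eq).symm

end AlphabetReduction

/-! ## The `k` greatest letters of `MatIdx m` and the dual weight of a `≤ k`-row shape -/

section TopLetters

variable {m : ℕ}

/-- The embedding of `Fin k` onto the `k` greatest lexicographic positions of `MatIdx m`
(`k ≤ m²`). [folklore] -/
theorem topLetters_strictMono {k : ℕ} (hk : k ≤ m * m) :
    StrictMono fun t : Fin k => matIdxEquiv m ⟨m * m - k + t, by omega⟩ := by
  intro s t hst
  apply (matIdxEquiv m).strictMono
  rw [Fin.lt_def]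
  simp only
  exact Nat.add_lt_add_left hst _

/-- The range of the top-letters embedding is an upper set. [folklore] -/
theorem isUpperSet_range_topLetters {k : ℕ} (hk : k ≤ m * m) :
    IsUpperSet (Set.range fun t : Fin k => matIdxEquiv m ⟨m * m - k + t, by omega⟩) := by
  intro i j hij hi
  obtain ⟨t, rfl⟩ := hi
  have hj : m * m - k ≤ ((matIdxEquiv m).symm j : ℕ) := by
    have h1 : (matIdxEquiv m) ⟨m * m - k + t, by omega⟩ ≤ (matIdxEquiv m) ((matIdxEquiv m).symm j) := by
      simpa using hij
    have h2 := ((matIdxEquiv m).le_iff_le).mp h1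
    rw [Fin.le_def] at h2
    simp only at h2
    omega
  refine ⟨⟨((matIdxEquiv m).symm j : ℕ) - (m * m - k), by have := ((matIdxEquiv m).symm j).2; omega⟩, ?_⟩
  simp only
  conv_rhs => rw [← (matIdxEquiv m).apply_symm_apply j]
  congr 1
  exact Fin.ext (by simp only; omega)

/-- **The dual weight of a `≤ k`-row shape lives on the `k` greatest letters**: for
`ℓ(λ) ≤ k ≤ m²`, `(dualOfPartition (m*m) λ).toMatIdx` is `dualOfPartition k λ` extended by zero
along the top-letters embedding. [folklore] -/
theorem toMatIdx_dualOfPartition_eq_extend_topLetters {k d : ℕ} (hk : k ≤ m * m)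
    (lam : Nat.Partition d) (hlam : lam.parts.card ≤ k) :
    (Weight.dualOfPartition (m * m) lam).toMatIdx =
      Function.extend (fun t : Fin k => matIdxEquiv m ⟨m * m - k + t, by omega⟩)
        (Weight.dualOfPartition k lam) 0 := by
  funext i
  obtain ⟨j, rfl⟩ : ∃ j : Fin (m * m), matIdxEquiv m j = i :=
    ⟨(matIdxEquiv m).symm i, (matIdxEquiv m).apply_symm_apply i⟩
  by_cases hj : m * m - k ≤ (j : ℕ)
  · -- in the range: `j = m*m - k + t`
    set t : Fin k := ⟨(j : ℕ) - (m * m - k), by omega⟩ with ht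
    have hjt : matIdxEquiv m j = (fun t : Fin k => matIdxEquiv m ⟨m * m - k + t, by omega⟩) t := by
      simp only [ht]
      congr 1
      exact Fin.ext (by simp only; omega)
    rw [hjt, (topLetters_strictMono hk).injective.extend_apply]
    simp only [Weight.toMatIdx, OrderIso.symm_apply_apply, Weight.dualOfPartition, Weight.dual,
      Weight.ofPartition_apply, Fin.val_rev, ht]
    congr 3
    omega
  · -- off the range: both sides vanish
    push Not at hj
    rw [Function.extend_apply' _ _ _ (fun ⟨t, ht⟩ => by
      have := congrArg (fun x => ((matIdxEquiv m).symm x : ℕ)) ht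
      simp only [OrderIso.symm_apply_apply] at this
      omega)]
    exact NoValuativeFlip.dualOfPartition_toMatIdx_eq_zero_of_lt lam j (by omega)

/-- **`pleth_{GL_{m²}}(λ*) = a_λ(δ[m])` computed in `GL_k`** for any `k` with `ℓ(λ) ≤ k ≤ m²`: the
plethysm coefficient of the dual weight of `λ` on the matrix letters equals
`plethysmCoeffOfPartition ℂ k m λ`. -/
theorem plethysmCoeff_toMatIdx_eq_plethysmCoeffOfPartition {k d : ℕ} (hk : k ≤ m * m)
    (lam : Nat.Partition d) (hlam : lam.parts.card ≤ k) :
    plethysmCoeff ℂ (MatIdx m) m (Weight.dualOfPartition (m * m) lam).toMatIdx =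
      plethysmCoeffOfPartition ℂ k m lam := by
  rw [toMatIdx_dualOfPartition_eq_extend_topLetters hk lam hlam, plethysmCoeffOfPartition]
  exact plethysmCoeff_extend_eq (topLetters_strictMono hk) (isUpperSet_range_topLetters hk) _

/-- In particular the `GL_k` plethysm number `plethysmCoeffOfPartition ℂ k m λ` does not depend on
`k ≥ ℓ(λ)` (alphabet stability; here for `ℓ(λ) ≤ k ≤ k' `, via any `m` with `k' ≤ m²`). -/
theorem plethysmCoeffOfPartition_eq_of_card_parts_le {k k' d : ℕ} (m : ℕ) (hkk' : k ≤ k')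
    (hk' : k' ≤ m * m) (lam : Nat.Partition d) (hlam : lam.parts.card ≤ k) :
    plethysmCoeffOfPartition ℂ k m lam = plethysmCoeffOfPartition ℂ k' m lam := by
  rw [← plethysmCoeff_toMatIdx_eq_plethysmCoeffOfPartition (hkk'.trans hk') lam hlam,
    ← plethysmCoeff_toMatIdx_eq_plethysmCoeffOfPartition hk' lam (hlam.trans hkk')]

end TopLetters

/-! ## The cap -/

section Cap

variable {m : ℕ}

/-- **Few-row plethysm cap (any orbit closure).** For a form `g` of degree `m ≥ 1` in the matrix
letters and `λ ⊢ d` with `ℓ(λ) ≤ k ≤ m²`: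
`mult_{λ*} ℂ[Δ_m(g)] ≤ a_λ = plethysmCoeffOfPartition ℂ k m λ` (BLMW Prop. 4.4.1,
`orbitMultiplicity_le_plethysmCoeff_holds`, then alphabet reduction). -/
theorem orbitMultiplicity_le_plethysmCoeffOfPartition_of_card_parts_le [NeZero m]
    {g : MvPolynomial (MatIdx m) ℂ} (hg : g.IsHomogeneous m) {k d : ℕ} (hk : k ≤ m * m)
    (lam : Nat.Partition d) (hlam : lam.parts.card ≤ k) :
    orbitMultiplicity ℂ g m (Weight.dualOfPartition (m * m) lam).toMatIdx ≤
      plethysmCoeffOfPartition ℂ k m lam := by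
  rw [← plethysmCoeff_toMatIdx_eq_plethysmCoeffOfPartition hk lam hlam]
  exact orbitMultiplicity_le_plethysmCoeff_holds g (NeZero.ne m) hg _

/-- **Few-row plethysm cap for the padded permanent.** For `n ≤ m` and `λ ⊢ mδ` with
`ℓ(λ) ≤ k ≤ m²`, the per side of the crux `ValuativeFlip` at `λ` is at most the `GL_k` plethysm
coefficient: `mult_{λ*} ℂ[Δ_m(X₀₀^{m-n} per_n)] ≤ a_λ(δ[m]) = plethysmCoeffOfPartition ℂ k m λ`.
For line `four-row-count` (`k = 4`): a four-row flip at `(n, m, δ, λ)` needs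
`dim T_U(λ) < a_λ(δ[m])`, an entry of the `GL₄` plethysm table. -/
theorem orbitMultiplicity_paddedPer_le_plethysmCoeffOfPartition {n m : ℕ} [NeZero m] (hnm : n ≤ m)
    {k δ : ℕ} (hk : k ≤ m * m) (lam : Nat.Partition (m * δ)) (hlam : lam.parts.card ≤ k) :
    orbitMultiplicity ℂ (paddedPerFormLex ℂ n m) m (Weight.dualOfPartition (m * m) lam).toMatIdx ≤
      plethysmCoeffOfPartition ℂ k m lam :=
  orbitMultiplicity_le_plethysmCoeffOfPartition_of_card_parts_le
    (paddedPerFormLex_isHomogeneous (k := ℂ) hnm) hk lam hlam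

/-- The same cap for the determinant orbit closure: `K_m(λ*) ≤ a_λ(δ[m])` in `GL_k`. -/
theorem orbitMultiplicity_det_le_plethysmCoeffOfPartition [NeZero m]
    {k δ : ℕ} (hk : k ≤ m * m) (lam : Nat.Partition (m * δ)) (hlam : lam.parts.card ≤ k) :
    orbitMultiplicity ℂ (detFormLex ℂ m) m (Weight.dualOfPartition (m * m) lam).toMatIdx ≤
      plethysmCoeffOfPartition ℂ k m lam :=
  orbitMultiplicity_le_plethysmCoeffOfPartition_of_card_parts_le
    (detFormLex_isHomogeneous ℂ m) hk lam hlam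

end Cap

end Summit.ValiantsHypothesis.ValiantsHypothesis.Theorems.ValuativeFlip

end
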